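import Summits.ABC.IUTFork.Joshi.UntiltRescaled
import Mathlib.NumberTheory.Padics.PadicVal.Basic
import Mathlib.Algebra.Module.Rat
import HarnessLib

/-!
# A second MODEL of the [J-I] points-signature: the «Frobenius line» — every move dilates UNIFORMLY, and a move of infinite order
# multiplies Joshi's scaling exponent by a fixed factor at every point (the law `‖·‖_{K_{φ(y)}} = ‖·‖^p_{K_y}` of a Frobenius translate)

Model file of the abc-iut cell, branch E (seat abc-iut-E-t1, [J-I] carrier owner; rung LADDER-ABC:A2.E). TAKES NO SIDE on [IUTchIII]
Cor. 3.12 or on any author; a model EXHIBITS satisfiability of typed hypotheses, nothing more; typed ≠ proved ≠ endorsed.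

WHY. The three-point signature `threePoint` (p432361) witnesses Joshi's `ActionDilates` ([J-I] v4 Cor 5.4.2 «there is no uniform choice of
α») with an INVOLUTION (the swap of `𝔽₂²`): along its orbits the exponent goes `1 ↦ c ↦ 1`, so no read-out of the exponent can be shifted
by a non-zero constant along a move — which is what a realisation of the move by a `p`-power scaling of the tensor packets does to
log-volumes (abc-iut-E-cx-3, TestUntiltsReadout; this seat's `DictionaryUntiltsReadout`). On the Fargues–Fontaine curve the situation is
different: the Frobenius `φ` has INFINITE order and multiplies the exponent by `p` at EVERY point (`K_{φ(y)}` is `K_y` with the tilt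
identification precomposed with Frobenius, so `|x|_{K_{φ(y)}} = |x|^p_{K_y}` under Joshi's tilt-normalised absolute values, [J-I] v4 §5.19 /
Thm 5.21.1 (4)); more generally multiplication by `p^k·u` on `𝒢(𝒪_F) ⊇` (a `ℤ_p`-line) shifts the «valuation of the point» by `k`. This
file builds the MINIATURE of that law over Mathlib, with no `p`-adic Hodge theory: `𝒪_E := ℤ`, `𝒢 := ℚ` (discrete), so
`|𝒴| := (ℚ − {0})/ℤ^× = ℚ^×/±1`, the residue field of the point `[x]` is `ℂ_p` with the norm rescaled by `b^{v_ℓ(x)}` (`ℓ` a fixed prime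
indexing the line, `b > 0` the dilatation base), and EVERY `σ ∈ Aut_ℤ(ℚ)` is a multiplication `x ↦ σ(1)·x`, shifting `v_ℓ` by `v_ℓ(σ 1)`.

WHAT IS HERE (ns `Summit.ABC.IUTFork.Joshi`, sub-namespace `FrobLine` for the auxiliaries).
* §1 `FrobLine.idx ℓ : ProjPoints ℤ ℚ → ℤ`, the `ℓ`-adic valuation of a point (well defined: `v_ℓ(−x) = v_ℓ(x)`); `FrobLine.linearEquiv_apply`:
  every `ℤ`-linear automorphism of `ℚ` is `x ↦ σ(1)·x` with `σ(1) ≠ 0`; `FrobLine.idx_projAct` / `idx_ptAct_frobLine`: `idx (σ·y) = v_ℓ(σ 1) + idx y`.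
* §2 **`frobLine p ℓ b hb : UntiltPoints p ℤ`** — the signature; `exponent_frobLine`: the scaling exponent of p431060 at `y` IS `b ^ idx y`;
  **`exponent_ptAct_frobLine`**: `exponent (σ·y) = b^{v_ℓ(σ 1)} · exponent y` for EVERY move and EVERY point (uniform dilatation);
  `FrobLine.mulLin`/`FrobLine.mulAut c`: multiplication by `c ≠ 0` as a move, `ptAct_mulAut_pt`, `idx_ptAct_mulAut`, `idx_ell_zpow`; **`frobLine_actionDilates`** (`b ≠ 1`: the move `×ℓ`
  multiplies every exponent by `b`); `frobLine_isDilatation`; `frobLine_topIso` (all residue fields homeomorphic: dilatation WITHOUT change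
  of topology — the model realises Cor 5.4.2, not the Kedlaya–Temkin non-homeomorphy `ExistsNonIsomorphic`, which is not claimed for it).
Standard axioms; the only inputs are Mathlib (`ℂ_[p]`, `padicValRat`, `map_rat_smul`) and this seat's `Untilt.rescaled` / `algClRescaled`
(p432361). Consumed by `TestUntiltsFrobeniusLine` (the log-faithful [J-I] dictionary at X-07′).
-/

noncomputable section

namespace Summit.ABC.IUTFork.Joshi

open UntiltPoints

/-! ## 1. Points `ℚ^×/±1`, their `ℓ`-adic index, and the moves `Aut_ℤ(ℚ)` -/

namespace FrobLine

variable (ℓ : ℕ)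

/-- A unit of `ℤ` acts on `ℚ` by `±1`, so it does not change `ℓ`-adic valuations. [folklore] -/
theorem padicValRat_units_smul (u : ℤˣ) (x : ℚ) : padicValRat ℓ (u • x) = padicValRat ℓ x := by
  rcases Int.units_eq_one_or u with rfl | rfl
  · rw [one_smul]
  · rw [Units.smul_def, Units.val_neg, Units.val_one, neg_smul, one_smul, padicValRat.neg]

/-- **The `ℓ`-adic index of a point of `ℚ^×/±1`**: `v_ℓ` of any representative. [folklore] -/
def idx : ProjPoints ℤ ℚ → ℤ :=
  Quotient.lift (fun g : {g : ℚ // g ≠ 0} => padicValRat ℓ (g : ℚ)) fun g h hgh => by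
    obtain ⟨u, hu⟩ := hgh
    show padicValRat ℓ (g : ℚ) = padicValRat ℓ (h : ℚ)
    rw [← hu, padicValRat_units_smul]

/-- The index of the class of `g` is `v_ℓ(g)`. [folklore] -/
theorem idx_mk (g : {g : ℚ // g ≠ 0}) : idx ℓ (Quotient.mk (unitRel ℤ ℚ) g) = padicValRat ℓ (g : ℚ) := rfl

/-- The class of a nonzero rational. [folklore] -/
def pt (x : ℚ) (hx : x ≠ 0) : ProjPoints ℤ ℚ := Quotient.mk (unitRel ℤ ℚ) ⟨x, hx⟩

/-- Its index is `v_ℓ(x)`. [folklore] -/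
theorem idx_pt (x : ℚ) (hx : x ≠ 0) : idx ℓ (pt x hx) = padicValRat ℓ x := rfl

variable {ℓ}

/-- **Every `ℤ`-linear automorphism of `ℚ` is a multiplication**: `σ x = σ 1 · x` (a `ℤ`-linear map between `ℚ`-vector spaces is
`ℚ`-linear, Mathlib `map_rat_smul`). [folklore] -/
theorem linearEquiv_apply (σ : ℚ ≃ₗ[ℤ] ℚ) (x : ℚ) : σ x = σ 1 * x := by
  have h : σ (x • (1 : ℚ)) = x • σ 1 := map_rat_smul (σ : ℚ →ₗ[ℤ] ℚ) x (1 : ℚ)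
  rw [smul_eq_mul, mul_one, smul_eq_mul] at h
  rw [h, mul_comm]

/-- … and the multiplier `σ 1` is nonzero. [folklore] -/
theorem linearEquiv_one_ne_zero (σ : ℚ ≃ₗ[ℤ] ℚ) : σ 1 ≠ 0 := fun h =>
  one_ne_zero ((LinearEquiv.map_eq_zero_iff σ).1 h)

/-- **A move shifts the index by the valuation of its multiplier**: `idx (σ·y) = v_ℓ(σ 1) + idx y`. [folklore] -/
theorem idx_projAct [Fact ℓ.Prime] (σ : ℚ ≃ₗ[ℤ] ℚ) (y : ProjPoints ℤ ℚ) :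
    idx ℓ (projAct σ y) = padicValRat ℓ (σ 1) + idx ℓ y := by
  induction y using Quotient.inductionOn with
  | h g =>
    show padicValRat ℓ (σ (g : ℚ)) = padicValRat ℓ (σ 1) + padicValRat ℓ (g : ℚ)
    rw [linearEquiv_apply σ, padicValRat.mul (linearEquiv_one_ne_zero σ) g.2]

/-- The exponent profile `b ^ idx` is positive for `b > 0`. [folklore] -/
theorem zpow_idx_pos {b : ℝ} (hb : 0 < b) (y : ProjPoints ℤ ℚ) : 0 < b ^ idx ℓ y := zpow_pos hb _

end FrobLine

/-! ## 2. The Frobenius-line signature and its uniform dilatations -/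

open FrobLine

variable (p ℓ : ℕ) [Fact p.Prime]

/-- **The FROBENIUS-LINE signature** `frobLine p ℓ b hb`: `𝒪_E := ℤ`, `𝒢 := ℚ` (discrete topology), `|𝒴| := (ℚ − {0})/ℤ^× = ℚ^×/±1`,
residue field of `[x]` the rescaled `ℂ_p^{(b^{v_ℓ(x)})}` (p432361's `Untilt.rescaled`), preferred algebraic closures the completion map,
Frobenius field left trivial (the Frobenius-LIKE move is the element `×ℓ` of `Aut_ℤ(ℚ)`, below). A MODEL of `UntiltPoints` (no claim of
Joshi's is used or asserted): the orbit `…, [ℓ⁻¹], [1], [ℓ], [ℓ²], …` carries the exponents `…, b⁻¹, 1, b, b², …` — the miniature of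
`‖·‖_{K_{φⁿ(y)}} = ‖·‖^{pⁿ}_{K_y}`. [folklore] -/
def frobLine (b : ℝ) (hb : 0 < b) : UntiltPoints p ℤ where
  Pt := ProjPoints ℤ ℚ
  untilt y := Untilt.rescaled p (b ^ idx ℓ y) (zpow_idx_pos hb y)
  frob := Equiv.refl _
  algCl y := algClRescaled p (b ^ idx ℓ y) (zpow_idx_pos hb y)
  continuous_algCl y := continuous_algClRescaled p (b ^ idx ℓ y) (zpow_idx_pos hb y)
  G := ℚ
  topologicalSpace := ⊥
  ptEquiv := Equiv.refl _

variable {p ℓ}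

/-- **The scaling exponent of p431060 at a point of the Frobenius line IS `b ^ idx y`** (`‖p‖_{K_y} = (p⁻¹)^{b^{idx y}}`). [folklore] -/
theorem exponent_frobLine (b : ℝ) (hb : 0 < b) (y : (frobLine p ℓ b hb).Pt) :
    (frobLine p ℓ b hb).exponent y = b ^ idx ℓ y := by
  have hp1 : 1 < (p : ℝ) := by exact_mod_cast (Fact.out : p.Prime).one_lt
  have h0 : 0 < ((p : ℝ))⁻¹ := inv_pos.2 (by linarith)
  have h1 : ((p : ℝ))⁻¹ ≠ 1 := (inv_lt_one_of_one_lt₀ hp1).ne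
  have hlog : Real.log ((p : ℝ)⁻¹) ≠ 0 := Real.log_ne_zero_of_pos_of_ne_one h0 h1
  unfold UntiltPoints.exponent UntiltPoints.normQp
  show Real.log ‖algClRescaled p (b ^ idx ℓ y) (zpow_idx_pos hb y) (algebraMap ℚ_[p] (AlgebraicClosure ℚ_[p]) p)‖ /
      Real.log ((p : ℝ)⁻¹) = b ^ idx ℓ y
  rw [norm_algClRescaled, show (algebraMap ℚ_[p] (AlgebraicClosure ℚ_[p]) (p : ℚ_[p]) : PadicAlgCl p) = (p : PadicAlgCl p)
    from map_natCast _ p, ← map_natCast (algebraMap ℚ_[p] (PadicAlgCl p)) p, PadicAlgCl.norm_extends, Padic.norm_p,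
    Real.log_rpow h0, mul_div_assoc, div_self hlog, mul_one]

/-- On the Frobenius line a move acts on points through `projAct` of its underlying linear automorphism (unfolding `ptAct`). [folklore] -/
theorem ptAct_frobLine (b : ℝ) (hb : 0 < b) (σ : (frobLine p ℓ b hb).Aut) (y : (frobLine p ℓ b hb).Pt) :
    (frobLine p ℓ b hb).ptAct σ y = projAct (σ.toLinearEquiv : ℚ ≃ₗ[ℤ] ℚ) (y : ProjPoints ℤ ℚ) := rfl

/-- … so the index of a moved point is shifted by the valuation of the move's multiplier. [folklore] -/
theorem idx_ptAct_frobLine [Fact ℓ.Prime] (b : ℝ) (hb : 0 < b) (σ : (frobLine p ℓ b hb).Aut) (y : (frobLine p ℓ b hb).Pt) :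
    idx ℓ ((frobLine p ℓ b hb).ptAct σ y) = padicValRat ℓ (σ.toLinearEquiv (1 : ℚ)) + idx ℓ y :=
  idx_projAct (σ.toLinearEquiv : ℚ ≃ₗ[ℤ] ℚ) y

/-- **EVERY move dilates UNIFORMLY**: `exponent (σ·y) = b^{v_ℓ(σ 1)} · exponent y` for every `σ ∈ Aut_ℤ(ℚ)` and every point `y` — the
multiplicative law of [J-I] v4 Thm 5.4.1 / Cor 5.4.2 with a factor depending on the move only. [folklore] -/
theorem exponent_ptAct_frobLine [Fact ℓ.Prime] (b : ℝ) (hb : 0 < b) (σ : (frobLine p ℓ b hb).Aut) (y : (frobLine p ℓ b hb).Pt) :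
    (frobLine p ℓ b hb).exponent ((frobLine p ℓ b hb).ptAct σ y) =
      b ^ padicValRat ℓ (σ.toLinearEquiv (1 : ℚ)) * (frobLine p ℓ b hb).exponent y := by
  rw [exponent_frobLine, exponent_frobLine, idx_ptAct_frobLine, zpow_add₀ hb.ne']

namespace FrobLine

/-- Multiplication by `c ≠ 0` as a `ℤ`-linear automorphism of `ℚ`. [folklore] -/
def mulLin (c : ℚ) (hc : c ≠ 0) : ℚ ≃ₗ[ℤ] ℚ where
  toFun x := c * x
  invFun x := c⁻¹ * x
  map_add' x y := mul_add c x y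
  map_smul' n x := by
    show c * (n • x) = n • (c * x)
    rw [zsmul_eq_mul, zsmul_eq_mul]
    ring
  left_inv x := by
    show c⁻¹ * (c * x) = x
    rw [inv_mul_cancel_left₀ hc]
  right_inv x := by
    show c * (c⁻¹ * x) = x
    rw [mul_inv_cancel_left₀ hc]

/-- `mulLin c` is `x ↦ c·x`. [folklore] -/
@[simp] theorem mulLin_apply (c : ℚ) (hc : c ≠ 0) (x : ℚ) : mulLin c hc x = c * x := rfl

/-- **Multiplication by `c ≠ 0` as a move** (a continuous `ℤ`-linear automorphism of the discrete `𝒢 = ℚ`). [folklore] -/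
def mulAut (b : ℝ) (hb : 0 < b) (c : ℚ) (hc : c ≠ 0) : (frobLine p ℓ b hb).Aut :=
  { mulLin c hc with
    continuous_toFun := continuous_bot
    continuous_invFun := continuous_bot }

/-- Its underlying linear automorphism is `mulLin c`. [folklore] -/
theorem mulAut_toLinearEquiv (b : ℝ) (hb : 0 < b) (c : ℚ) (hc : c ≠ 0) :
    ((mulAut (p := p) (ℓ := ℓ) b hb c hc).toLinearEquiv : ℚ ≃ₗ[ℤ] ℚ) = mulLin c hc := rfl

/-- Its multiplier is `c`. [folklore] -/
theorem mulAut_toLinearEquiv_one (b : ℝ) (hb : 0 < b) (c : ℚ) (hc : c ≠ 0) :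
    (mulAut (p := p) (ℓ := ℓ) b hb c hc).toLinearEquiv (1 : ℚ) = c := by
  show c * 1 = c
  exact mul_one c

/-- It moves the point `[x]` to `[c·x]`. [folklore] -/
theorem ptAct_mulAut_pt (b : ℝ) (hb : 0 < b) (c : ℚ) (hc : c ≠ 0) (x : ℚ) (hx : x ≠ 0) :
    (frobLine p ℓ b hb).ptAct (mulAut b hb c hc) (pt x hx) = pt (c * x) (mul_ne_zero hc hx) :=
  Quotient.sound ⟨1, one_smul _ _⟩

/-- … shifting the index by `v_ℓ(c)`. [folklore] -/
theorem idx_ptAct_mulAut [Fact ℓ.Prime] (b : ℝ) (hb : 0 < b) (c : ℚ) (hc : c ≠ 0) (y : (frobLine p ℓ b hb).Pt) :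
    idx ℓ ((frobLine p ℓ b hb).ptAct (mulAut b hb c hc) y) = padicValRat ℓ c + idx ℓ y := by
  rw [idx_ptAct_frobLine, mulAut_toLinearEquiv_one]

/-- The point `[1]` has index `0` … [folklore] -/
theorem idx_one [Fact ℓ.Prime] : idx ℓ (pt 1 one_ne_zero) = 0 := by rw [idx_pt, padicValRat.one]

/-- … and `[ℓ^k]` has index `k` (the orbit of `[1]` under `×ℓ` is infinite). [folklore] -/
theorem idx_ell_zpow [hℓ : Fact ℓ.Prime] (k : ℤ) :
    idx ℓ (pt ((ℓ : ℚ) ^ k) (zpow_ne_zero k (Nat.cast_ne_zero.2 hℓ.out.ne_zero))) = k := by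
  rw [idx_pt, padicValRat.zpow, padicValRat.self hℓ.out.one_lt, mul_one]

end FrobLine

/-- **`ActionDilates` HOLDS on the Frobenius line** (`b ≠ 1`): the move `×ℓ` carries `[1]` (exponent `1`) to `[ℓ]` (exponent `b`). So the
premise of the [J-I]-cluster locations (`DictionaryUntiltsVolume`, `DictionaryUntiltsReadout`) is satisfiable on a signature whose
dilating move has INFINITE order and acts uniformly. [folklore] -/
theorem frobLine_actionDilates [hℓ : Fact ℓ.Prime] (b : ℝ) (hb : 0 < b) (hb1 : b ≠ 1) : (frobLine p ℓ b hb).ActionDilates := by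
  rw [UntiltPoints.actionDilates_iff_exponent_ne]
  refine ⟨FrobLine.mulAut b hb ℓ (Nat.cast_ne_zero.2 hℓ.out.ne_zero), FrobLine.pt 1 one_ne_zero, ?_⟩
  rw [exponent_ptAct_frobLine, FrobLine.mulAut_toLinearEquiv_one, padicValRat.self hℓ.out.one_lt, zpow_one, exponent_frobLine,
    FrobLine.idx_one, zpow_zero, mul_one]
  exact hb1

/-- … with the explicit dilatation factor along `×c`: `IsDilatation y (c·y) (b^{v_ℓ(c)})` at EVERY point. [folklore] -/
theorem frobLine_isDilatation [Fact ℓ.Prime] (b : ℝ) (hb : 0 < b) (c : ℚ) (hc : c ≠ 0) (y : (frobLine p ℓ b hb).Pt) :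
    (frobLine p ℓ b hb).IsDilatation y ((frobLine p ℓ b hb).ptAct (FrobLine.mulAut b hb c hc) y) (b ^ padicValRat ℓ c) := by
  rw [UntiltPoints.isDilatation_iff_eq_div, exponent_ptAct_frobLine, FrobLine.mulAut_toLinearEquiv_one,
    mul_div_assoc, div_self ((frobLine p ℓ b hb).exponent_pos y).ne', mul_one]

/-- The residue fields of the model are pairwise topologically isomorphic: the model realises uniform DILATATION (Cor 5.4.2), not the
Kedlaya–Temkin non-homeomorphy (`ExistsNonIsomorphic` is not claimed for it). [folklore] -/
theorem frobLine_topIso (b : ℝ) (hb : 0 < b) (y y' : (frobLine p ℓ b hb).Pt) :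
    ((frobLine p ℓ b hb).untilt y).TopIso ((frobLine p ℓ b hb).untilt y') :=
  rescaled_topIso p _ _ _ _

end Summit.ABC.IUTFork.Joshi

end
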